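import Mathlib
import Summits.NavierStokesRegularity.NavierStokesRegularity.Theses.TypeIQuarterGate
import Summits.NavierStokesRegularity.NavierStokesRegularity.Theses.ExtremalTypeIConstant
import Summits.NavierStokesRegularity.NavierStokesRegularity.Theorems.ExtremalTypeIConstantSelfSimilarExcluded
import Summits.NavierStokesRegularity.NavierStokesRegularity.Theorems.SqueezeCycleExtremalElementExistsExtraction
import Summits.NavierStokesRegularity.NavierStokesRegularity.Theorems.SymmetryModuliCountLinearLiouvilleSevenFiniteEnergy
import Summits.NavierStokesRegularity.NavierStokesRegularity.Theorems.LerayQuarterDissipationFiniteDissipationLiouvilleDssCorners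
import Summits.NavierStokesRegularity.NavierStokesRegularity.Theorems.TypeIQuarterGateScarZoomDefs
import Summits.NavierStokesRegularity.NavierStokesRegularity.Theorems.QuarterLogPincerThinCascadeDefs
import Literature.Analysis.FluidPDE.TypeIAncientMild
import Literature.Analysis.FluidPDE.TypeIAncientMildRescale
import Literature.Analysis.FluidPDE.SelfSimilar
import Literature.Analysis.FluidPDE.ChaeWolfRemovingDSS
import Summits.NavierStokesRegularity.NavierStokesRegularity.Theorems.QuantisedSymmetryPolyhedralDssProfileExistsStubAncientMildOfClassicalTypeI
import Literature.Barriers.NavierStokesRegularity.NearOneDssTypeIExclusion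

/-!
# Line `axis-activity` — DSS-wall rung line filed under crux `TypeIQuarterGate.ScarEnvelopeTypeI`
(stmt-NavierStokesRegularity-23843). Seat ns-idea-7 g3, lens «nearmiss», target «DSS wall».

**No summit is proved by this line, and it does NOT conclude the crux `ScarEnvelopeTypeI`.**
It is a rung line on the crux's wall: the crux's conclusion — the SPACE–TIME ENVELOPE
`‖u(t,x)‖ ≤ C' + Σ C'/(‖x − a‖ + √(T − t))` of a Type-I blow-up — is exactly what feeds blow-up zooms
into the envelope class `HasTypeIDecay C₀` in which the DSS wall (`TypeIDSSLiouville`) and its one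
theorem, the near-one exclusion of Chae–Wolf 2017 (Thm 1.3 = tree `chaeWolf2017_removing_dss_holds`,
barrier `NearOneDssTypeIExclusion`, scope caveat (a): the Type-I ENVELOPE on all of `ℝ³ × (−∞,0)`;
caveat (d): the envelope is derived only from `C((−∞,0);Lᵖ)`, Thm 1.1), are stated.  This line shows
that ON THE NEAR-ONE LANE THE ENVELOPE IS NOT NEEDED: the measured deficit "envelope hypothesis" of
the near-one theorem is removed, in the time-rate class `IsTypeIAncientMild M` (KNSS Oseen gauge,
`‖u(t,x)‖ ≤ M/√(−t)`, NO spatial decay) that Type-I blow-up zooms actually deliver.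

## Mechanism (the lever: AXIS ACTIVITY)

In Chae–Wolf's indirect argument (nontrivial `λₙ`-DSS solutions, `λₙ → 1`, converge to a nontrivial
SELF-SIMILAR solution, killed by Tsai) the envelope is used exactly once: to keep the point of
nontriviality at BOUNDED similarity ratio `‖x‖/√(−t)` (the envelope `C₀/(‖x‖+√(−t))` forces every
point with `√(−t)‖u‖ ≥ ε` to have ratio `≤ C₀/ε`), so that the symmetry centre does not escape to
infinity in the limit.  The lever replacing it is a structural fact about the time-rate class:

* `AxisActivity` (S_A, NEW — PROVED in this file as `axisActivity_proof`, v4): there are `ε > 0` (absolute) and `R₀ = R₀(M)` such that every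
  NONTRIVIAL `u ∈ A_M = IsTypeIAncientMild M` has a point with `‖x‖ < R₀ √(−t)` and
  `√(−t)‖u(t,x)‖ ≥ ε` — activity inside the parabola around the time axis (hence, by translation
  invariance of the class, around EVERY vertical axis).  Proof sketch (provable now from tree
  theorems): if `u` is `ε`-quiet in the parabola `{‖x‖ < R√(−t)}` with `R` huge, recentre at an active
  point of nearly minimal ratio `ρ ≥ R` and rescale it to time `−1`; in the new frame `u` is
  `ε`-quiet on `{t < −1, ‖z‖ < ρ(√(−t) − 1) − 1}`, which exhausts the past `t < −1` as `R → ∞`; the class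
  compactness `exists_tendsto_of_isTypeIAncientMild_seq` (KNSS Lemma 6.1 + Prop 4.1, tree theorem)
  gives a limit in `A_M`, `ε`-quiet on the whole end `t ≤ −2`, hence ZERO by the small-constant
  Liouville on an end `exists_typeIAncientMild_eq_zero_of_small_on_end` (tree theorem), yet of size
  `≥ ε` at `(−1, 0)` — contradiction (continuity on the open slab).  The same end-Liouville shows the
  active set of a nontrivial element is nonempty.
* `ScaleDensification` (S_D — PROVED in this file as `scaleDensification_proof`, v3; was a stub in v1/v2): a pointwise limit `W ∈ A_M` of `cₙ`-DSS fields `vₙ ∈ A_M` with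
  `cₙ → 1` is scale invariant on `t < 0` (`cₙ^{kₙ} → μ` for every `μ > 0`; the class-uniform KNSS
  Prop 4.1 bounds IN THE TREE — `Theorems.exists_norm_iteratedFDeriv_le_of_typeI` (spatial gradient) and
  `Theorems.exists_lipschitz_time_of_typeI` (time-Lipschitz) — pass the pointwise convergence through the
  moving arguments `(cₙ^{2kₙ}t, cₙ^{kₙ}x)`).
* `SelfSimilarGenerator` (S_G — PROVED in this file as `selfSimilarGenerator_proof`, v2): scale invariance of a smooth field on `t < 0` gives the
  infinitesimal generator identity `∇W·x + W + 2t ∂ₜW = 0` (differentiate `μ ↦ μW(μ²t, μx)` at `μ = 1`),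
  the hypothesis form of the CLOSED item `ExtremalTypeIConstant.SelfSimilarExcluded`
  (stmt-NavierStokesRegularity-8219, proved: Tsai 1998 Thm 1 at `q = ∞` via `BoundedProfileConstant`
  stmt-8220 + the Oseen identity).

v7 (2026-08-28T10:40Z): + `thinObject_not_nearOneDss` — the same constraint on the residual THIN OBJECT of 24077's
registered line `thin_cascade` (S3's object class).

v6 (2026-08-28T10:30Z): + `chaeWolf_of_nearOneRateDss : NearOneRateDss → chaeWolf2017_removing_dss` (kernel, via the
tree's `isTypeIAncientMild_of_classical_typeI`): the rung DOMINATES Chae–Wolf 2017 Thm 1.3 — it is that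
theorem with the envelope hypothesis dropped (the tree already proves CW 1.3 itself,
`chaeWolf2017_removing_dss_holds`; this only certifies the comparison).

v5 (2026-08-28T10:10Z): + the CONSUMER COROLLARY `twinScarObject_not_nearOneDss` (end of file): the residual
object of both registered 23843 lines — an A–B-class twin-scar Type-I ancient mild solution
`ScarZoom.TwinScarObject M v` — is not `c`-DSS about any centre for `1 < c < c₁(M)` (kernel; a proved
CONSTRAINT on the residual enemy, like SF; not a kill).

KERNEL-CHECKED HERE (v4: the file has NO `sorry` — S_A `axisActivity_proof`, S_D `scaleDensification_proof`,
S_G `selfSimilarGenerator_proof` are proved below, and `nearOneRateDss_proof : NearOneRateDss` is a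
sorry-free theorem of this workfile; landing it under `Theorems/` is the LEAD's / a prover's proposal,
this seat is files-only):
`nearOneRateDss_of : AxisActivity → ScaleDensification → SelfSimilarGenerator →
NearOneRateDss`, the indirect argument itself — choice of a violating sequence `cₙ ↓ 1`, active points
by S_A, parabolic rescaling to time `−1` (`IsTypeIAncientMild.nsRescale`, commuting scalings keep the
DSS about the origin), Bolzano–Weierstrass for the marked points, the class compactness theorem BY
NAME, nontriviality of the limit at `(−1, y_inf)` through locally uniform slice convergence, S_D, S_G,
and `extremalTypeIConstant_selfSimilarExcluded_proof` BY NAME.  The printed ENVELOPE form inside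
the gauge class is already a tree theorem (`nearOneEnvelope_inTree` =
`FiniteDissipationLiouville.Birth.exists_dss_threshold_of_envelope`, threshold `c₁(C₀)`); the rung
deletes its envelope hypothesis and makes the threshold depend on the rate constant `M`
(`nearOneEnvelope_of_nearOneRate`).

`NearOneRateDss` is STRICTLY STRONGER than the near-one theorem in print (same conclusion, weaker
hypothesis: rate instead of envelope; the gauge class is the tree's zoom-limit class) and strictly
weaker than `NoTypeI` / the crux.  It is not the DSS wall (coarse ratios untouched) and says so.

LANDING NOTE.  Author: ideator seat ns-idea-7 (g3/g4), line `axis-activity` v7 (tree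
`Cruxes/ScarEnvelopeTypeI/Lines/axis_activity.lean`, sha16 e0717fe785a7ef30; idea-crit-7 g2 VERDICT PASS 10:27:26Z, item L);
landed VERBATIM under `Theorems/` by the prover hand ns-in-wu-con g2 (DIRECTOR-NS KEY-NS #135 (2)(L) / #136 (5) / inputs-15 (b2)),
split in THREE files only for the 400-line rule (declarations byte-identical; the local notation `(EuclideanSpace ℝ (Fin 3))` spelled out as
`EuclideanSpace ℝ (Fin 3)`; deprecated `push_neg` → `push Not` for 0-warning hygiene; `set_option linter.dupNamespace false` added as in every Theorems file): part 1/3 `…NearOneRateDssAxisActivity.lean` (the four statements + S_A `axisActivity_proof` +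
`exists_recentred`, `isDiscretelySelfSimilar_pow`), part 2/3 `…NearOneRateDssDensification.lean` (S_D `scaleDensification_proof`,
S_G `selfSimilarGenerator_proof`, rescaling lemmas), part 3/3 `…NearOneRateDss.lean` (the rung `nearOneRateDss_proof` and its
corollaries `chaeWolf_of_nearOneRateDss`, `twinScarObject_not_nearOneDss`, `thinObject_not_nearOneDss`, …).
No summit is proved; the line does NOT conclude crux 23843 `ScarEnvelopeTypeI`; NS regularity is NOT proved.
-/

noncomputable section

-- the summit and its single sub-problem share the name (CONVENTIONS §1), as in every Theorems file
set_option linter.dupNamespace false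

namespace Summit.NavierStokesRegularity.NavierStokesRegularity.Cruxes.ScarEnvelopeTypeI.AxisActivity

open MeasureTheory Set Function Filter Topology Bornology
open Literature.Analysis Literature.Analysis.FluidPDE
open Summit.NavierStokesRegularity.NavierStokesRegularity.Theorems
open Summit.NavierStokesRegularity.NavierStokesRegularity.Theses.ExtremalTypeIConstant


/-! ## The statements -/

/-- **S_A — AXIS ACTIVITY (the lever; PROVED below, `axisActivity_proof`, v4; was the stub `stub_axisActivity` in v1–v3).**  There is an absolute
`ε > 0` and, for every rate constant `M`, a ratio `R₀ = R₀(M)` such that every nontrivial Type-I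
ancient mild field `u ∈ A_M` (KNSS Oseen gauge, `‖u(t,x)‖ ≤ M/√(−t)`, no spatial decay assumed) is
ACTIVE INSIDE THE PARABOLA OF APERTURE `R₀` AROUND THE TIME AXIS: some `(x,t)`, `t < 0`,
`‖x‖ < R₀√(−t)`, carries `√(−t)‖u(t,x)‖ ≥ ε`.  (By translation invariance of the class the same holds
around every vertical axis.)  This is the substitute for the Type-I ENVELOPE in every
symmetry-densification argument on the DSS wall.  Why it might fail: it does not, if the sketch in
the module docstring is right — the risk is the bookkeeping of the quiet region under recentring
(the region `{t<−1, ‖z‖ < ρ(√(−t)−1)−1}` must exhaust the past as `ρ → ∞`; it does).  Sources: KNSS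
2009 Lemma 6.1 / Prop 4.1 (arXiv:0709.3599) = tree `exists_tendsto_of_isTypeIAncientMild_seq`;
Leray 1934 (3.9) = tree `exists_typeIAncientMild_eq_zero_of_small_on_end`. -/
def AxisActivity : Prop :=
  ∃ ε : ℝ, 0 < ε ∧ ∀ M : ℝ, ∃ R₀ : ℝ, ∀ u : ℝ → (EuclideanSpace ℝ (Fin 3)) → (EuclideanSpace ℝ (Fin 3)), IsTypeIAncientMild M u →
    (∃ t < 0, ∃ x, u t x ≠ 0) →
      ∃ t < 0, ∃ x : (EuclideanSpace ℝ (Fin 3)), ‖x‖ < R₀ * Real.sqrt (-t) ∧ ε ≤ Real.sqrt (-t) * ‖u t x‖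

/-- **S_D — SCALE DENSIFICATION (PROVED below, `scaleDensification_proof`, v3; was a stub in v1/v2).**  If `vₙ ∈ A_M` are `cₙ`-discretely
self-similar with `cₙ > 1`, `cₙ → 1`, and converge pointwise on the open slab to `W ∈ A_M`, then `W`
is invariant under EVERY parabolic scaling on `t < 0`: `μ W(μ²t, μx) = W(t,x)` for all `μ > 0`.
(For `μ > 0` pick `kₙ ∈ ℤ` with `cₙ^{kₙ} → μ`; `vₙ = (vₙ)_{cₙ^{kₙ}}`; the uniform KNSS Prop 4.1
bounds of the class make the family equicontinuous on compact subsets of the open slab, so pointwise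
convergence is locally uniform in space–time and passes through the moving arguments
`(cₙ^{2kₙ}t, cₙ^{kₙ}x)`.)  Why it might fail: only through a slip in the equicontinuity-in-time step
(Prop 4.1 gives `|∂ₜv| ≲ M-dependent/(−t)^{3/2}` on the class).  Sources: KNSS 2009 Prop 4.1
(arXiv:0709.3599 p. 8) = tree `KNSS2009_prop41_mild_holds`; Chae–Wolf 2017 §3 Step 2
(arXiv:1610.09464 p. 9, the densification `λⱼ^{k} → μ`). -/
def ScaleDensification : Prop :=
  ∀ (M : ℝ) (c : ℕ → ℝ) (v : ℕ → ℝ → (EuclideanSpace ℝ (Fin 3)) → (EuclideanSpace ℝ (Fin 3))) (W : ℝ → (EuclideanSpace ℝ (Fin 3)) → (EuclideanSpace ℝ (Fin 3))),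
    (∀ n, 1 < c n) → Tendsto c atTop (𝓝 1) →
    (∀ n, IsTypeIAncientMild M (v n)) → (∀ n, IsDiscretelySelfSimilar (c n) (v n)) →
    IsTypeIAncientMild M W → (∀ t < 0, ∀ x, Tendsto (fun n => v n t x) atTop (𝓝 (W t x))) →
      ∀ μ : ℝ, 0 < μ → ∀ t < 0, ∀ x : (EuclideanSpace ℝ (Fin 3)), μ • W (μ ^ 2 * t) (μ • x) = W t x

/-- **S_G — THE SELF-SIMILAR GENERATOR (PROVED below, `selfSimilarGenerator_proof`, v2; was a stub in v1).**  A field of the class that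
is invariant under all parabolic scalings on `t < 0` satisfies the infinitesimal identity
`∇W(t)·x + W + 2t ∂ₜW = 0` there (differentiate `μ ↦ μ W(μ²t, μx)` at `μ = 1`; the class is jointly
`C^∞` on the open slab) — the hypothesis form, with centre `a = 0`, of the closed item
`ExtremalTypeIConstant.SelfSimilarExcluded` (stmt-NavierStokesRegularity-8219).  Why it might fail:
it does not (chain rule); kept as a separate stub because the `timeDeriv`/`fderiv` bookkeeping of the
uncurried field is real Lean work.  Sources: Leray 1934 (3.11); tree `SelfSimilar.lean`
(`IsSelfSimilar.eq_lerayBackward`), `WeakSolution.timeDeriv`. -/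
def SelfSimilarGenerator : Prop :=
  ∀ (M : ℝ) (W : ℝ → (EuclideanSpace ℝ (Fin 3)) → (EuclideanSpace ℝ (Fin 3))), IsTypeIAncientMild M W →
    (∀ μ : ℝ, 0 < μ → ∀ t < 0, ∀ x : (EuclideanSpace ℝ (Fin 3)), μ • W (μ ^ 2 * t) (μ • x) = W t x) →
      ∀ t < 0, ∀ x : (EuclideanSpace ℝ (Fin 3)), fderiv ℝ (W t) x ((0 : (EuclideanSpace ℝ (Fin 3))) + x) + W t x + (2 * t) • timeDeriv W t x = 0

/-- **THE RUNG: near-one DSS exclusion in the TIME-RATE class (no envelope).**  For every rate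
constant `M` there is `c₁ = c₁(M) > 1` such that every Type-I ancient mild field `u ∈ A_M` (KNSS
Oseen gauge on `ℝ³ × (−∞,0)`: jointly smooth, divergence free, Oseen-mild between all pairs of
negative times, `‖u(t,x)‖ ≤ M/√(−t)` — NO spatial decay) which is `c`-discretely self-similar about
the origin with `1 < c < c₁` vanishes on `t < 0`.  Print (Chae–Wolf 2017 Thm 1.3 = Pineau–Vicol 2026
Thm 1.6) needs the space–time envelope `C₀/(‖x‖ + √(−t))`; time-rate DSS profiles may a priori
carry satellite singular rays `{cᵏ e}` at the final time and lie outside `C((−∞,0);Lᵖ)`, so neither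
Thm 1.1 nor Thm 1.3 applies to them. -/
def NearOneRateDss : Prop :=
  ∀ M : ℝ, ∃ c₁ : ℝ, 1 < c₁ ∧ ∀ c : ℝ, 1 < c → c < c₁ →
    ∀ u : ℝ → (EuclideanSpace ℝ (Fin 3)) → (EuclideanSpace ℝ (Fin 3)), IsTypeIAncientMild M u → IsDiscretelySelfSimilar c u →
      ∀ t < 0, ∀ x, u t x = 0

/-! ## The former stubs — ALL PROVED (v4: S_A; v3: S_D; v2: S_G).  The file has no `sorry`. -/

/-- **Minimal-ratio recentring.**  If `u ∈ A_M` has an `ε`-active point and is `ε`-quiet in the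
parabola of aperture `R > 0` about the time axis, then recentring at an active point of nearly
minimal similarity ratio and rescaling its time to `−1` produces `w ∈ A_M` with `‖w(−1,0)‖ ≥ ε` that
is `ε`-quiet on `{‖y‖ < R(√(−s) − 2)}`. -/
theorem exists_recentred {ε M R : ℝ} (hR : 0 < R) {u : ℝ → (EuclideanSpace ℝ (Fin 3)) → (EuclideanSpace ℝ (Fin 3))} (hu : IsTypeIAncientMild M u)
    (hact : ∃ t < 0, ∃ x : (EuclideanSpace ℝ (Fin 3)), ε ≤ Real.sqrt (-t) * ‖u t x‖)
    (hq : ∀ t < 0, ∀ x : (EuclideanSpace ℝ (Fin 3)), ‖x‖ < R * Real.sqrt (-t) → Real.sqrt (-t) * ‖u t x‖ < ε) :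
    ∃ w : ℝ → (EuclideanSpace ℝ (Fin 3)) → (EuclideanSpace ℝ (Fin 3)), IsTypeIAncientMild M w ∧ ε ≤ ‖w (-1) 0‖ ∧
      ∀ s < 0, ∀ y : (EuclideanSpace ℝ (Fin 3)), ‖y‖ < R * (Real.sqrt (-s) - 2) → Real.sqrt (-s) * ‖w s y‖ < ε := by
  -- the set of similarity ratios of active points
  set S : Set ℝ := {r | ∃ t < 0, ∃ x : (EuclideanSpace ℝ (Fin 3)), ε ≤ Real.sqrt (-t) * ‖u t x‖ ∧ r = ‖x‖ / Real.sqrt (-t)}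
    with hS_def
  have hne : S.Nonempty := by
    obtain ⟨t, ht, x, hx⟩ := hact
    exact ⟨‖x‖ / Real.sqrt (-t), t, ht, x, hx, rfl⟩
  have hbdd : BddBelow S := ⟨0, fun r ⟨t, ht, x, hx, hr⟩ => hr ▸ div_nonneg (norm_nonneg _) (Real.sqrt_nonneg _)⟩
  -- every active ratio is at least `R`
  have hlb : ∀ r ∈ S, R ≤ r := by
    rintro r ⟨t, ht, x, hx, rfl⟩
    have hst : 0 < Real.sqrt (-t) := Real.sqrt_pos.2 (by linarith)
    rw [le_div_iff₀ hst]
    by_contra h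
    exact absurd (hq t ht x (lt_of_not_ge h)) (not_lt.2 hx)
  set ρ : ℝ := sInf S with hρ_def
  have hRρ : R ≤ ρ := le_csInf hne hlb
  have hρ : 0 < ρ := hR.trans_le hRρ
  -- an active point of nearly minimal ratio
  obtain ⟨r, hrS, hr2⟩ := exists_lt_of_csInf_lt hne (show sInf S < 2 * ρ by linarith)
  obtain ⟨t₀, ht₀, x₀, hx₀, rfl⟩ := hrS
  -- minimality: points of ratio `< ρ` are quiet
  have hmin : ∀ t < 0, ∀ x : (EuclideanSpace ℝ (Fin 3)), ‖x‖ / Real.sqrt (-t) < ρ → Real.sqrt (-t) * ‖u t x‖ < ε := by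
    intro t ht x hlt
    by_contra h
    have hmem : ‖x‖ / Real.sqrt (-t) ∈ S := ⟨t, ht, x, not_lt.1 h, rfl⟩
    exact absurd (csInf_le hbdd hmem) (not_le.2 hlt)
  -- recentre at `x₀`, rescale `t₀` to `-1`
  set lam : ℝ := Real.sqrt (-t₀) with hlam_def
  have hlam : 0 < lam := Real.sqrt_pos.2 (by linarith)
  have hlam2 : lam ^ 2 = -t₀ := Real.sq_sqrt (by linarith)
  set w : ℝ → (EuclideanSpace ℝ (Fin 3)) → (EuclideanSpace ℝ (Fin 3)) := nsRescale lam (fun t x => u t (x + x₀)) with hw_def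
  have hw : IsTypeIAncientMild M w := (hu.comp_add_right x₀).nsRescale hlam
  have hw_apply : ∀ s y, w s y = lam • u (lam ^ 2 * s) (lam • y + x₀) := fun s y => rfl
  refine ⟨w, hw, ?_, ?_⟩
  · -- size at `(-1, 0)`
    rw [hw_apply, smul_zero, zero_add, hlam2, show -t₀ * (-1 : ℝ) = t₀ by ring, norm_smul,
      Real.norm_of_nonneg hlam.le]
    exact hx₀
  · intro s hs y hy
    have hss : 0 < Real.sqrt (-s) := Real.sqrt_pos.2 (by linarith)
    -- the hypothesis is vacuous unless `√(-s) - 2 > 0`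
    have hpos : 0 < Real.sqrt (-s) - 2 := by
      by_contra h
      have : R * (Real.sqrt (-s) - 2) ≤ 0 := mul_nonpos_of_nonneg_of_nonpos hR.le (not_lt.1 h)
      exact absurd (hy.trans_le this) (not_lt.2 (norm_nonneg y))
    have hy' : ‖y‖ < ρ * (Real.sqrt (-s) - 2) :=
      hy.trans_le (mul_le_mul_of_nonneg_right hRρ hpos.le)
    -- the original point
    have ht : lam ^ 2 * s < 0 := mul_neg_of_pos_of_neg (by positivity) hs
    have hsqrt : Real.sqrt (-(lam ^ 2 * s)) = lam * Real.sqrt (-s) := by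
      rw [show -(lam ^ 2 * s) = lam ^ 2 * (-s) by ring, Real.sqrt_mul (by positivity),
        Real.sqrt_sq hlam.le]
    have hr₀ : ‖x₀‖ / lam < 2 * ρ := hr2
    have hratio : ‖lam • y + x₀‖ / Real.sqrt (-(lam ^ 2 * s)) < ρ := by
      rw [hsqrt, div_lt_iff₀ (mul_pos hlam hss)]
      have h1 : ‖lam • y + x₀‖ ≤ lam * ‖y‖ + ‖x₀‖ := by
        calc ‖lam • y + x₀‖ ≤ ‖lam • y‖ + ‖x₀‖ := norm_add_le _ _
          _ = lam * ‖y‖ + ‖x₀‖ := by rw [norm_smul, Real.norm_of_nonneg hlam.le]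
      have h2 : ‖x₀‖ < 2 * ρ * lam := by rwa [div_lt_iff₀ hlam] at hr₀
      have h3 : lam * ‖y‖ < lam * (ρ * (Real.sqrt (-s) - 2)) := mul_lt_mul_of_pos_left hy' hlam
      nlinarith
    have hquiet := hmin (lam ^ 2 * s) ht (lam • y + x₀) hratio
    -- transport the value
    have e : Real.sqrt (-s) * ‖w s y‖ = Real.sqrt (-(lam ^ 2 * s)) * ‖u (lam ^ 2 * s) (lam • y + x₀)‖ := by
      rw [hw_apply, norm_smul, Real.norm_of_nonneg hlam.le, hsqrt]; ring
    rw [e]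
    exact hquiet

/-- **S_A PROVED (v4, 2026-08-28): axis activity.**  Take `ε` = the threshold of the end Liouville
theorem `exists_typeIAncientMild_eq_zero_of_small_on_end`.  If for some `M` no aperture works, pick for
every `n` a nontrivial `uₙ ∈ A_M` that is `ε`-quiet in the parabola of aperture `n + 1`; each `uₙ` has an
`ε`-active point (else it is `ε`-small on an end, hence zero); recentre at an active point of nearly
minimal similarity ratio (`exists_recentred`): `wₙ ∈ A_M`, `‖wₙ(−1,0)‖ ≥ ε`, `ε`-quiet on
`{‖y‖ < (n+1)(√(−s) − 2)}`; by the class compactness theorem `exists_tendsto_of_isTypeIAncientMild_seq`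
(BY NAME) a subsequence converges pointwise to `W ∈ A_M` with `‖W(−1,0)‖ ≥ ε` and `ε`-small on the end
`s ≤ −5` — so `W ≡ 0` by the end Liouville theorem: contradiction. -/
theorem axisActivity_proof : AxisActivity := by
  obtain ⟨ε, hε, hLiou⟩ := exists_typeIAncientMild_eq_zero_of_small_on_end
  refine ⟨ε, hε, fun M => ?_⟩
  by_contra hcon
  push Not at hcon
  -- for every aperture `n + 1` a nontrivial quiet-in-the-parabola element
  choose u hu hnt hq using fun n : ℕ => hcon ((n : ℝ) + 1)
  -- each has an active point (else the end Liouville theorem makes it zero)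
  have hact : ∀ n, ∃ t < 0, ∃ x : (EuclideanSpace ℝ (Fin 3)), ε ≤ Real.sqrt (-t) * ‖u n t x‖ := by
    intro n
    by_contra h
    push Not at h
    have hsmall : ∀ t, t ≤ -(1 : ℝ) → ∀ x, ‖u n t x‖ ≤ ε / Real.sqrt (-t) := by
      intro t ht x
      have hst : 0 < Real.sqrt (-t) := Real.sqrt_pos.2 (by linarith)
      rw [le_div_iff₀ hst, mul_comm]
      exact (h t (by linarith) x).le
    have hzero := hLiou M (u n) (hu n) 1 one_pos hsmall
    obtain ⟨t, ht, x, hx⟩ := hnt n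
    exact hx (hzero t ht x)
  -- recentred elements
  have hrec := fun n : ℕ => exists_recentred (ε := ε) (M := M) (R := (n : ℝ) + 1) (by positivity)
    (hu n) (hact n) (hq n)
  choose w hw hwε hwq using hrec
  -- compactness of the class
  obtain ⟨φ, hφ, W, hW, hpt, -, -, -⟩ := exists_tendsto_of_isTypeIAncientMild_seq M hw
  -- the limit is large at `(-1, 0)` …
  have hW1 : ε ≤ ‖W (-1) 0‖ :=
    ge_of_tendsto ((hpt (-1) (by norm_num) 0).norm) (Eventually.of_forall fun j => hwε (φ j))
  -- … and `ε`-quiet on the end `t ≤ -5`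
  have hWsmall : ∀ t, t ≤ -(5 : ℝ) → ∀ x, ‖W t x‖ ≤ ε / Real.sqrt (-t) := by
    intro s hs y
    have hs0 : s < 0 := by linarith
    have hss : 0 < Real.sqrt (-s) := Real.sqrt_pos.2 (by linarith)
    have hpos : 0 < Real.sqrt (-s) - 2 := by
      have : (2 : ℝ) < Real.sqrt (-s) := by
        rw [show (2 : ℝ) = Real.sqrt 4 by rw [show (4 : ℝ) = 2 ^ 2 by norm_num, Real.sqrt_sq (by norm_num)]]
        exact Real.sqrt_lt_sqrt (by norm_num) (by linarith)
      linarith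
    have hT : Tendsto (fun j => ((φ j : ℕ) : ℝ) + 1) atTop atTop :=
      tendsto_atTop_add_const_right _ _ (tendsto_natCast_atTop_atTop.comp hφ.tendsto_atTop)
    have hev : ∀ᶠ j in atTop, Real.sqrt (-s) * ‖w (φ j) s y‖ ≤ ε := by
      filter_upwards [(hT.atTop_mul_const hpos).eventually_gt_atTop ‖y‖] with j hj
      exact (hwq (φ j) s hs0 y hj).le
    have hlim : Tendsto (fun j => Real.sqrt (-s) * ‖w (φ j) s y‖) atTop (𝓝 (Real.sqrt (-s) * ‖W s y‖)) :=
      ((hpt s hs0 y).norm).const_mul _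
    have h := le_of_tendsto hlim hev
    rw [le_div_iff₀ hss, mul_comm]
    exact h
  have hzero := hLiou M W hW 5 (by norm_num) hWsmall
  have h0 : W (-1) 0 = 0 := hzero (-1) (by norm_num) 0
  rw [h0, norm_zero] at hW1
  exact absurd hW1 (not_le.2 hε)

/-- ℕ-iterates of a discrete self-similarity (`nsRescale_mul`, `nsRescale_one`). -/
theorem isDiscretelySelfSimilar_pow {c : ℝ} {u : ℝ → (EuclideanSpace ℝ (Fin 3)) → (EuclideanSpace ℝ (Fin 3))}
    (h : IsDiscretelySelfSimilar c u) (k : ℕ) : IsDiscretelySelfSimilar (c ^ k) u := by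
  induction k with
  | zero =>
    show nsRescale (c ^ 0) u = u
    rw [pow_zero, nsRescale_one]
  | succ k ih =>
    have h' : nsRescale c u = u := h
    have ih' : nsRescale (c ^ k) u = u := ih
    show nsRescale (c ^ (k + 1)) u = u
    rw [pow_succ, nsRescale_mul, ih', h']

end Summit.NavierStokesRegularity.NavierStokesRegularity.Cruxes.ScarEnvelopeTypeI.AxisActivity

end
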